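import Summits.QuantumFields.YangMills.Theorems.BalabanUVNodesN12ChartBRestrictHullCount
import HarnessLib

/-!
# BalabanUVNodes ∕ N12 — (D1)⁵ §2 AT PRINT's [II] (2.3) DATUM (`…N12Prop1DirectOfClassOnlyRowL1UniformBLam`): the (P4)′ letter family `hHrow` DISPLAYED BY L2ᴮ
# (`…N12Prop1DirectOfClassOnlyRowL1NearRadiusDatumScaleAtLengthB`) is INHABITED, with its two constants `εH`, `B₁` chosen PER HEIGHT, by dag-n12-w6's print-datum hull-count socket
# `…N12ChartBRestrictHullCount.exists_rightInverse_hrow_uniformB_lamBondsSeq` (✓p775374)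

[Balaban1984PropagatorsII] = «[II]», (2.3) p. 224 (print's determining datum `Λ_j` = the DIFFERENCE of bond sets — fewer constrained bonds than reading (b)); [Balaban1985Variational] =
«[15]», Sect. C (44)–(48) p. 285, (82)–(83) p. 290; [Balaban1988Convergent] = «[III]», (2.2) p. 255, (2.10)–(2.13) pp. 256–257; consumer [Balaban1989LargeFieldII] («[IV]») Prop. 1 p. 194.

Cell `pub-ymgap` (HUMAN RULINGS D-0062 ∕ D-0149), seat `pub-ymgap-dag-n12-d` g33 (R134 N12 [B15] s2; the (ii) Theorems-side re-key of N12's 12Q-DIRECT road at print's datum —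
director-ym №338 ∕ №343 (E1)(iii-b); dag-n12-c DESIGN memo a793b2ebc0b803bf (ii); split with dag-n12-w6 of 2026-08-30: (R) restriction adapters = w6, junctions = this seat).
Count-neutral helper of K1⁹ `stmt-QuantumFields-27364` (`--kind proof --supports … --as helper`).  THEOREMS ONLY (0 `def`, 0 `instance`, 0 `sorry`); ONE `choose` BY NAME over
dag-n12-w6 g24's ✓p775374 — nothing else.  Imports green (no `Record13*`).  Namespace per the cell's convention (i): `…<Parent>Lam` (record-specific print edition), the parent being
`…N12Prop1DirectOfClassOnlyRowL1UniformB` (dag-n12-d g21, the (b)-datum junction over dag-n12-w6 g9's `…DirectSurjHullCountUniformB.exists_rightInverse_hrow_uniformB`).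

WHY.  L2ᴮ displays the (P4)′ letter family `hHrow i : ∀ Wd U₀, AgreeOn (Bj ν.M₁ (Z i) (k i)) (M˙U₀) Wd → (one guarded proxy per (b)-row) → (one guarded proxy per inner site) →
(tower-box plaquette letter at εH i) → ∃ H, (right inverse of D(msChartB … (lamBondsSeq (maxDomT ν.M₁ (Z i)) (k i)) Wd U₀)(0)) ∧ (per-row ℓ¹ preimage letter at B₁ i over PRINT's rows)`
at binders `εH B₁ : ι → ℝ` — by design the inner ∀-body of w6's print-datum hull-count socket (the (b)-socket's `H` restricted along the row map `lamBondsSeq ≤ bondsDet (genSet …)`;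
the HYPOTHESES stay in (b)-currency since they are properties of the base point and of the data, only the CONCLUSION moves to print's rows).  THIS FILE is the junction: `∃ εH B₁ : ι → ℝ`
(functions of the height family `k` alone) `∀ ν (2 ≤ M₁) Z (hdiv) i Wd U₀ …` — the parent's statement with the conclusion's `msChart … (Bj …)` ↦ `msChartB … (lamBondsSeq (maxDomT …) …)`
and `constrCard ∕ constrEnum (Bj …)` ↦ `constrCardB ∕ constrEnumB (lamBondsSeq …)` in the conclusion ONLY.

WHAT.  ★★ `exists_rowPreimageProxiesLetter_family_uniformB_lamBondsSeq (Kt) (k : ι → ℕ) (hk1 : ∀ i, k i + 1 ≤ m + K)`.  Proof: `choose` over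
`exists_rightInverse_hrow_uniformB_lamBondsSeq (k := k i) (hk1 i)`, dropping its two norm conjuncts (`‖H v‖ ≤ B₁Σ‖v i‖`, `Σ_b‖H v b‖ ≤ B₁Σ‖v i‖`).

HONEST FRAMING ∕ LOCATED.  ∃∕∀ bookkeeping by name; `B₁ i`'s VALUE still carries dag-n12-w6's (b)-hull count `h(d,L,k)·B` (their LOCATED-ε∕B-VALUE; print's volume-free (46) NOT
claimed); nothing about existence ∕ minimality over print's larger class; nothing of Bałaban's estimates asserted or refuted; count-neutral; N12 NOT discharged; K0⁷ ∕ K1⁹ NOT closed;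
counts of record unmoved (typed 28∕28 · discharged 8∕27); one finite 𝕋⁴ programme at fixed `ε = L^{-K}` — R4 closes only the conditional rung `BalabanLadder.UV`; no summit statement is
proved here and NOT the Yang–Mills mass gap (Clay); nothing continuum ∕ ℝ⁴ ∕ OS.
-/

noncomputable section

open scoped BigOperators Matrix.Norms.L2Operator

namespace Summit.QuantumFields.YangMills.BalabanUVNodes.N12Prop1DirectOfClassOnlyRowL1UniformBLam

open Literature.MathematicalPhysics.QuantumFieldTheory.Balaban1983to89
open Node00 B15DeterminingSets B15DeterminingSetsB GaugeField
open T4Continuum (T4Family)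
open T4AdjointCovarianceUnitary (lieSU)
open T4CubeChartGnomonic (SU2)
open B14.Eq213DetSet (Bj maxDomT)
open B14.Eq213MaximalDomains (side)
open B14.Eq216Concrete (feeds)
open B5Eq118OneStroke (iterBlockOf)
open B15Eq112TorusCover (lift)
open T4AxialGaugeSmallField (boxPlaqs)
open Summit.QuantumFields.YangMills.BalabanUVNodes.N12ChartBRestrictHullCount (exists_rightInverse_hrow_uniformB_lamBondsSeq)

variable {F : T4Family}

/-- ★★ **JUNCTION AT PRINT's [II] (2.3) DATUM, UNIFORM-`B₁` EDITION (count-neutral)**: L2ᴮ's displayed (P4)′ letter family `hHrow` ((b)-fibre base row `AgreeOn (Bj …) (M˙U₀) Wd`, one guarded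
proxy per (b)-row and per inner site, the tower-box plaquette letter at `εH i`; conclusion = a right inverse `H` of `D(msChartB … (lamBondsSeq (maxDomT ν.M₁ (Z i)) (k i)) Wd U₀)(0)` + the
per-row ℓ¹ preimage letter at `B₁ i` over print's rows) is inhabited with `εH i > 0` AND `B₁ i ≥ 0` depending on the HEIGHT `k i` ALONE — chosen before `ν`, `M₁`, the family `Z` and the
instance — by dag-n12-w6 g24's `exists_rightInverse_hrow_uniformB_lamBondsSeq` (✓p775374; SAME `ε`, SAME `B₁` as the (b)-socket).  The parent's `exists_rowPreimageProxiesLetter_family_uniformB`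
with the conclusion at print's datum.  Needs `k i + 1 ≤ m + K`; at use `2 ≤ ν.M₁` and (2.13)'s divisibility per instance.
[cite: Balaban1984PropagatorsII, (2.3) p.224; Balaban1985Variational, (44)–(47) p.285, (83) p.290; Balaban1988Convergent, (2.2) p.255, (2.11)–(2.13) pp.256–257; Balaban1989LargeFieldII, (1.13) p.359] -/
theorem exists_rowPreimageProxiesLetter_family_uniformB_lamBondsSeq (Kt : ℕ) {ι : Type} (k : ι → ℕ) (hk1 : ∀ i, k i + 1 ≤ (F.P Kt).m + (F.P Kt).K) :
    ∃ εH : ι → ℝ, (∀ i, 0 < εH i) ∧ ∃ B₁ : ι → ℝ, (∀ i, 0 ≤ B₁ i) ∧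
      ∀ (ν : Node00.Stage7Numerics), 2 ≤ ν.M₁ → ∀ (Z : ι → Set (Site (F.P Kt) 0)), (∀ i, side (F.P Kt).L ν.M₁ (k i) ∣ (F.P Kt).sitesPerDir 0) →
      ∀ i (Wd : MSField (F.P Kt) SU2) (U₀ : GaugeField (F.P Kt) 0 SU2),
      AgreeOn (Bj ν.M₁ (Z i) (k i)) (avgFamily (Node00.avOfRecord F 2 Kt) U₀) Wd →
      (∀ i' : Fin (constrCard (Bj ν.M₁ (Z i) (k i)) (k i)), ∃ U' : GaugeField (F.P Kt) 0 SU2,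
        (∀ b ∈ feeds (((constrEnum (Bj ν.M₁ (Z i) (k i)) (k i)).symm i').1 : ℕ) ((constrEnum (Bj ν.M₁ (Z i) (k i)) (k i)).symm i').2.1, U' b = U₀ b) ∧
          Node00.SmallBelow (Node00.avOfRecord F 2 Kt) (k i) U') →
      (∀ (j : ℕ), 1 ≤ j → j ≤ k i → ∀ y : Site (F.P Kt) j, embIter j y ∈ maxDomT ν.M₁ (Z i) j → ∃ U' : GaugeField (F.P Kt) 0 SU2,
        (∀ c : PBond (F.P Kt) j, (c.src = y ∨ c.tgt = y) → ∀ b₀ : PBond (F.P Kt) 0,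
          (iterBlockOf j b₀.src = c.src ∨ iterBlockOf j b₀.src = c.tgt) → (iterBlockOf j b₀.tgt = c.src ∨ iterBlockOf j b₀.tgt = c.tgt) → U' b₀ = U₀ b₀) ∧
        Node00.SmallBelow (Node00.avOfRecord F 2 Kt) (k i) U') →
      (∀ (j : ℕ), 1 ≤ j → j ≤ k i → ∀ y : Site (F.P Kt) j, embIter j y ∈ maxDomT ν.M₁ (Z i) j →
        PlaqSmallOn (boxPlaqs (fun κ => lift (F.P Kt) (embIter j y) κ - ((((F.P Kt).L ^ j : ℕ) : ℤ) + ((((F.P Kt).L ^ j - 1) / 2 : ℕ) : ℤ)))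
          (fun κ => lift (F.P Kt) (embIter j y) κ + ((((F.P Kt).L ^ j : ℕ) : ℤ) + ((((F.P Kt).L ^ j - 1) / 2 : ℕ) : ℤ))) : Set (Plaq (F.P Kt) 0)) (εH i) U₀) →
      ∃ H : (Fin (constrCardB (lamBondsSeq (maxDomT ν.M₁ (Z i)) (k i)) (k i)) → lieSU (Fin 2)) → PBond (F.P Kt) 0 → lieSU (Fin 2),
        (∀ v, fderiv ℝ (msChartB F 2 Kt (k i) (lamBondsSeq (maxDomT ν.M₁ (Z i)) (k i)) Wd U₀) 0 (H v) = v) ∧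
        ∀ i' : Fin (constrCardB (lamBondsSeq (maxDomT ν.M₁ (Z i)) (k i)) (k i)), 1 ≤ ((((constrEnumB (lamBondsSeq (maxDomT ν.M₁ (Z i)) (k i)) (k i)).symm i').1 : ℕ)) → ∀ ξ : lieSU (Fin 2),
          ∃ x : PBond (F.P Kt) 0 → lieSU (Fin 2), fderiv ℝ (msChartB F 2 Kt (k i) (lamBondsSeq (maxDomT ν.M₁ (Z i)) (k i)) Wd U₀) 0 x = Pi.single i' ξ ∧
            ∑ b, ‖(x b : Matrix (Fin 2) (Fin 2) ℂ)‖ ≤ B₁ i * ‖ξ‖ := by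
  choose εH hεH B₁ hB1 hB using fun i => exists_rightInverse_hrow_uniformB_lamBondsSeq (F := F) (N := 2) (K := Kt) (k := k i) (hk1 i)
  refine ⟨εH, hεH, B₁, hB1, fun ν hM2 Z hdiv i Wd U₀ hU hprox hproxS hbox => ?_⟩
  obtain ⟨H, hHinv, -, -, hrow⟩ := hB i ν.M₁ (le_trans one_le_two hM2) (Z i) (hdiv i) Wd U₀ hU hprox hproxS hbox
  exact ⟨H, hHinv, hrow⟩

end Summit.QuantumFields.YangMills.BalabanUVNodes.N12Prop1DirectOfClassOnlyRowL1UniformBLam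

end
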